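import Summits.QuantumFields.YangMills.Theorems.FlatTubeReductionRecordProfileHT
import Summits.QuantumFields.YangMills.Theorems.FlatTubeReductionDressedHTEventuallyRExplicit
import Summits.QuantumFields.YangMills.Theorems.FlatTubeReductionStiffTransfer
import Summits.QuantumFields.YangMills.Theorems.FlatTubeReductionProfileNormalisation
import HarnessLib

/-!
# ★★★★ THE (B-ST) PORT, ASSEMBLED: lane A's stiff gap for the UN-normalised record profile at the rate twin's window (`recordChi L (1/6) (42D+1) M`, constant
# `Λ_A = (btC/fpZ/γ_A)·λ₀`, gap `θ_A`) ⟹ ALL structural fields + `hN` + `hT` + `hST` of `RateTube.AnalyticRatePotInput L D M` for the shared profile `Ω = n_β·recordProfile L β`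
# (`θ₀ = θ_A/2`); only `hODpot` (with `b, κ_b`) then remains
# (route `FlatTubeReduction`, crux K1 `NearFlatRatioLaw` stmt-QuantumFields-24720; seat `ym-line-ftr-p1` g17; rate twin «ratepack-v5»; R2b1 RECORD rung — no summit statement is proved here)

WHY (NOTES `## ST-PORT`).  Lane A's (B-ST) pen (`…BOStiffAssembly.hST_of_pieces` + the `…BOStiff*Record` instance files, assembling now for `recordChi L s 43 M`) produces an `hST`-shaped
bound for `v ⊥ Ω_c` fibrewise with the constant `(btC L β Ω_c (btEps β) R₁/fpZ (btEps β)/recordGamma Ω_c β)·λ₀`.  The rate twin needs it for `Ω = n_β·Ω_c`, window constant `42D+1`,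
exponent `s = 1/6`, normalisation `σ_β = c_β/γ_β` (`c_β = f_β(1)/(2fpZ)` from `…DressedHTEventuallyRExplicit`).  This file proves that such a bound — taken as a HYPOTHESIS at our `(s, K)`,
for any core radius `R₁` — yields our `hST` with `θ₀ = θ_A/2`: orthogonality transfers by `…StiffTransfer.hST_transfer_eventually` (normaliser positivity from `profileDressing_package_Rpos`),
and the constants compare by `btC ≤ f_β(1)` (`…StiffTransfer.btC_le_diag`), `mass_β(1) ≤ (1 + aλ_b²)·γ_A` (`…FibreMassPointwiseRecordR` at `u = 1`), `γ_β = n_β(1)²·mass_β(1)`,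
`n_β(1)²·m̃_β(1) = ½`, `|m̃_β(1) − 1| ≤ ε_β` (the package's window identities at `u = 1`) — `port_comparison`.
* `eventually_mul_bareLambda_sq_le`, `port_comparison` (scalar), ★★★★ `recordProfile_analytic_of_hST`.
HONEST FRAMING: a CONDITIONAL assembly (lane A's (B-ST) at `(1/6, 42D+1)` is the hypothesis; their pen is OPEN); `hODpot`-rate remains crux-sized; femto rung R2b1 (RECORD label); not infinite
volume, not a gap, not Clay.  No defs, no named facts, no `sorry`.
-/

set_option autoImplicit false

noncomputable section

open MeasureTheory Filter Topology Real
open scoped BigOperators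
open Literature.MathematicalPhysics.QuantumFieldTheory
open Literature.MathematicalPhysics.QuantumLattice

namespace Summit.QuantumFields.YangMills.Theorems.FemtoTransferGap.RateTube

open Summit.QuantumFields.YangMills.Theorems.FemtoTransferGap
open Summit.QuantumFields.YangMills.Theorems.FemtoTransferGap.TwoLattice
open Summit.QuantumFields.YangMills.Theorems.FemtoTransferGap.TwoLattice.ConstTube
open Summit.QuantumFields.YangMills.Theorems.FemtoTransferGap.TwoLattice.Avg
open Summit.QuantumFields.YangMills.Theorems.FemtoTransferGap.TwoLattice.Stiff (LinkSpace)

variable {L : ℕ} [NeZero L]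

/-- `a·λ_b(L³β)² ≤ c` eventually, for `a ≥ 0`, `c > 0`. [folklore] -/
theorem eventually_mul_bareLambda_sq_le {a c : ℝ} (ha : 0 ≤ a) (hc : 0 < c) : ∀ᶠ β : ℝ in atTop, a * bareLambda ((L : ℝ) ^ 3 * β) ^ 2 ≤ c := by
  filter_upwards [mul_bareLambda_sq_eventually_le (L := L) (show 0 ≤ a / (4 * c) by positivity)] with β h
  have h' := mul_le_mul_of_nonneg_left h (show (0 : ℝ) ≤ 4 * c by positivity)
  calc a * bareLambda ((L : ℝ) ^ 3 * β) ^ 2 = 4 * c * (a / (4 * c) * bareLambda ((L : ℝ) ^ 3 * β) ^ 2) := by field_simp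
    _ ≤ 4 * c * (1 / 4) := h'
    _ = c := by ring

omit [NeZero L] in
/-- **The scalar comparison of the (B-ST) port.**  With `0 < θ ≤ 1`, `0 ≤ b ≤ F` (`b = btC`, `F = f(1)`), `Z, γ_A > 0`, `λ₀ ≥ 0`, the window identities at `u = 1`
(`n₁²·m₁ = ½`, `|m₁ − 1| ≤ ε`, `0 < m₁`), the exact mass `n₁²·mass₁ = γ > 0`, and `mass₁ ≤ (1 + η)·γ_A` with `0 ≤ η, ε ≤ θ/8`:
`(1 − θ)·(b/Z/γ_A·λ₀) ≤ (1 − θ/2)·((F/2/Z)/γ·λ₀)`. [folklore] -/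
theorem port_comparison {θ b F Z γA lam n₁ m₁ mass₁ γ η ε : ℝ} (hθ0 : 0 < θ) (hθ1 : θ ≤ 1) (hb0 : 0 ≤ b) (hbF : b ≤ F) (hZ : 0 < Z) (hγA : 0 < γA) (hlam : 0 ≤ lam)
    (hnm : n₁ ^ 2 * m₁ = 1 / 2) (hm1 : |m₁ - 1| ≤ ε) (hm0 : 0 < m₁) (hγ : n₁ ^ 2 * mass₁ = γ) (hγ0 : 0 < γ) (hmass : mass₁ ≤ (1 + η) * γA)
    (hη0 : 0 ≤ η) (hη : η ≤ θ / 8) (hε : ε ≤ θ / 8) :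
    (1 - θ) * (b / Z / γA * lam) ≤ (1 - θ / 2) * (F / 2 / Z / γ * lam) := by
  have hF0 : 0 ≤ F := hb0.trans hbF
  have hn2 : 0 < n₁ ^ 2 := by
    rcases (sq_nonneg n₁).eq_or_lt with h | h
    · rw [← h, zero_mul] at hnm; norm_num at hnm
    · exact h
  have hmass0 : 0 < mass₁ := by
    rcases lt_or_ge 0 mass₁ with h | h
    · exact h
    · nlinarith
  -- `γ = mass₁/(2m₁)`
  have hγe : γ = mass₁ / (2 * m₁) := by
    rw [← hγ, eq_div_iff (by positivity)]
    calc n₁ ^ 2 * mass₁ * (2 * m₁) = 2 * (n₁ ^ 2 * m₁) * mass₁ := by ring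
      _ = mass₁ := by rw [hnm]; ring
  have hm1' : 1 - θ / 8 ≤ m₁ := by have := (abs_le.mp hm1).1; linarith
  -- the key scalar inequality `(1−θ)·b·mass₁ ≤ (1−θ/2)·F·m₁·γ_A`
  have hkey : (1 - θ) * b * mass₁ ≤ (1 - θ / 2) * F * m₁ * γA := by
    have h1 : (1 - θ) * b * mass₁ ≤ (1 - θ) * F * ((1 + η) * γA) :=
      mul_le_mul (mul_le_mul_of_nonneg_left hbF (by linarith)) hmass hmass0.le (mul_nonneg (by linarith) hF0)
    have h2 : (1 - θ) * (1 + η) ≤ (1 - θ / 2) * (1 - θ / 8) := by nlinarith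
    have h3 : (1 - θ) * F * ((1 + η) * γA) = ((1 - θ) * (1 + η)) * (F * γA) := by ring
    have h4 : ((1 - θ) * (1 + η)) * (F * γA) ≤ ((1 - θ / 2) * (1 - θ / 8)) * (F * γA) := mul_le_mul_of_nonneg_right h2 (mul_nonneg hF0 hγA.le)
    have h5 : ((1 - θ / 2) * (1 - θ / 8)) * (F * γA) ≤ ((1 - θ / 2) * m₁) * (F * γA) :=
      mul_le_mul_of_nonneg_right (mul_le_mul_of_nonneg_left hm1' (by linarith)) (mul_nonneg hF0 hγA.le)
    calc (1 - θ) * b * mass₁ ≤ ((1 - θ) * (1 + η)) * (F * γA) := by rw [← h3]; exact h1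
      _ ≤ ((1 - θ / 2) * m₁) * (F * γA) := h4.trans h5
      _ = (1 - θ / 2) * F * m₁ * γA := by ring
  rw [hγe]
  have e1 : (1 - θ) * (b / Z / γA * lam) = ((1 - θ) * b * mass₁) * (lam / (Z * γA * mass₁)) := by field_simp
  have e2 : (1 - θ / 2) * (F / 2 / Z / (mass₁ / (2 * m₁)) * lam) = ((1 - θ / 2) * F * m₁ * γA) * (lam / (Z * γA * mass₁)) := by field_simp
  rw [e1, e2]
  exact mul_le_mul_of_nonneg_right hkey (by positivity)

set_option maxHeartbeats 1600000 in
/-- ★★★★ **THE (B-ST) PORT, ASSEMBLED.**  `L ≥ 2` (with a non-zero site), `D ≥ 1`, any core radius `R₁ : ℝ → ℝ`.  There is `M₀ ≥ 2` such that for every `M ≥ M₀` and every `θ_A ∈ (0,1]`: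
IF lane A's stiff gap holds at the rate twin's window — eventually in `β`, every bounded measurable `v` supported in `{recordChi L (1/6) (42D+1) M β ≠ 0}` with
`fibreInner (softWeight χ_β) (recordProfile L β) v u = 0` for all `u` has `tubeForm β v ≤ (1−θ_A)·((btC L β (recordProfile L β) (btEps β) (R₁ β)/fpZ (btEps β)/recordGamma L (recordProfile L) β)·λ₀)·
T_β(v)` — THEN there are `Ω = n_β·recordProfile L β`, `W, γ, σ, κ, κ_W, C_W` satisfying, conjunct by conjunct, the fields `hΩm … hκ_small, hN, hT` of `RateTube.AnalyticRatePotInput L D M`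
(as in `…RecordProfileHT.recordProfile_hN_hT`) AND its `hST` field with `θ₀ = θ_A/2`: eventually every bounded measurable `v` supported in `{χ_β ≠ 0}` with
`fibreInnerAd (softWeight χ_β) (Ω β) v u = 0` for all `u` has `tubeForm β v ≤ (1−θ_A/2)·(σ_β·λ₀)·T_β(v)`. [cite: Luscher1983, §3] -/
theorem recordProfile_analytic_of_hST (hL2 : 2 ≤ L) (hL : Nonempty (NzSite L)) {D : ℝ} (hD : 1 ≤ D) (R₁ : ℝ → ℝ) :
    ∃ M₀ : ℝ, 2 ≤ M₀ ∧ ∀ M : ℝ, M₀ ≤ M → ∀ θA : ℝ, 0 < θA → θA ≤ 1 →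
      (∀ᶠ β : ℝ in atTop, ∀ v : GaugeConfig 3 L SU2 → ℝ, Measurable v → (∃ C : ℝ, ∀ U, |v U| ≤ C) → (∀ U, v U ≠ 0 → recordChi L (1 / 6) (42 * D + 1) M β U ≠ 0) →
        (∀ u, fibreInner L (softWeight (recordChi L (1 / 6) (42 * D + 1) M β)) (recordProfile L β) v u = 0) →
        tubeForm β v ≤ (1 - θA) * (btC L β (recordProfile L β) (btEps β) (R₁ β) / fpZ (btEps β) / recordGamma L (recordProfile L) β * levelValue su2Rep 1 ((L : ℝ) ^ 3 * β) 0) *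
          tubeNormSq (softWeight (recordChi L (1 / 6) (42 * D + 1) M β)) v) →
      ∃ (Ω : ℝ → GaugeConfig 3 1 SU2 → LinkSpace L → ℝ) (W : ℝ → GaugeConfig 3 1 SU2 → ℝ) (γ σ κ : ℝ → ℝ) (κW CW : ℝ),
        (∃ n : ℝ → GaugeConfig 3 1 SU2 → ℝ, (∀ β, Measurable (n β)) ∧ (∀ β u, 0 ≤ n β u ∧ n β u ≤ 1) ∧
          (∀ β (g : Site 3 1 → SU2) (u : GaugeConfig 3 1 SU2), n β (gaugeTransform g u) = n β u) ∧
          (∀ β u, 0 < fibreMass L (softWeight (recordChi L (1 / 6) (42 * D + 1) M β)) (recordProfile L β) u → 0 < n β u) ∧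
          Ω = fun β u x => n β u * recordProfile L β x) ∧
        (∀ β, Measurable (Function.uncurry (Ω β))) ∧ (∀ β u x, |Ω β u x| ≤ 1) ∧
        (∀ β (g : SU2) (u : GaugeConfig 3 1 SU2) (v : LinkSpace L), Ω β (gaugeTransform (fun _ : Site 3 1 => g) u) (adL L g v) = Ω β u v) ∧
        (∀ β u x, Ω β u x ≠ 0 → ‖x‖ ≤ min (1 / 40) (powScale (1 / 2) β * btLog β)) ∧
        (∀ β, IsPhys (W β)) ∧ (∀ β u, 0 ≤ W β u) ∧ (∀ β u, |W β u| ≤ CW) ∧ 0 ≤ κW ∧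
        (∀ β u, orbitDist u < D * recordDelta1 L (1 / 6) β → |W β u ^ 2 - 1| ≤ κW * orbitDist u ^ 2) ∧
        (∀ β : ℝ, 0 ≤ min (1 / 40) (powScale (1 / 2) β * btLog β) ∧ min (1 / 40) (powScale (1 / 2) β * btLog β) ≤ 1 / 2) ∧
        (∀ᶠ β : ℝ in atTop, 12 * Fintype.card (Site 3 L) * min (1 / 40) (powScale (1 / 2) β * btLog β) < powScale (1 / 6) β) ∧
        (∀ β, 0 < γ β) ∧ (∀ β, 0 < σ β) ∧ (∀ β, 0 ≤ κ β) ∧ (∃ a : ℝ, ∀ᶠ β in atTop, κ β ≤ a * bareLambda ((L : ℝ) ^ 3 * β) ^ 2) ∧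
        (∀ᶠ β in atTop, ∀ u : GaugeConfig 3 1 SU2, orbitDist u < D * recordDelta1 L (1 / 6) β →
          |fibreMassAd L (softWeight (recordChi L (1 / 6) (42 * D + 1) M β)) (Ω β) u - γ β| ≤ κ β * γ β) ∧
        (∀ᶠ β in atTop, ∀ φ : GaugeConfig 3 1 SU2 → ℝ, Measurable φ → (∃ C : ℝ, ∀ u, |φ u| ≤ C) →
          (∀ (g : Site 3 1 → SU2) (u : GaugeConfig 3 1 SU2), φ (gaugeTransform g u) = φ u) → (∀ u, φ u ≠ 0 → orbitDist u < D * recordDelta1 L (1 / 6) β) →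
          |tubeForm β (boFunAd L φ (Ω β)) - σ β * γ β * qform su2Rep ((L : ℝ) ^ 3 * β) (fun u => φ u * W β u) (fun u => φ u * W β u)| ≤
            κ β * (σ β * γ β) * (qform su2Rep ((L : ℝ) ^ 3 * β) (fun u => φ u * W β u) (fun u => φ u * W β u) + levelValue su2Rep 1 ((L : ℝ) ^ 3 * β) 0 * l2 φ φ)) ∧
        (∀ᶠ β : ℝ in atTop, ∀ v : GaugeConfig 3 L SU2 → ℝ, Measurable v → (∃ C : ℝ, ∀ U, |v U| ≤ C) → (∀ U, v U ≠ 0 → recordChi L (1 / 6) (42 * D + 1) M β U ≠ 0) →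
          (∀ u, fibreInnerAd L (softWeight (recordChi L (1 / 6) (42 * D + 1) M β)) (Ω β) v u = 0) →
          tubeForm β v ≤ (1 - θA / 2) * (σ β * levelValue su2Rep 1 ((L : ℝ) ^ 3 * β) 0) * tubeNormSq (softWeight (recordChi L (1 / 6) (42 * D + 1) M β)) v) := by
  have hD0 : 0 ≤ D := zero_le_one.trans hD
  obtain ⟨hΩm, hΩ01, hCΩ, hΩinv⟩ := recordProfile_fields L
  have hΩ0 : ∀ β x, 0 ≤ recordProfile L β x := fun β x => (hΩ01 β x).1
  obtain ⟨hR0, hRsmall, hR1⟩ := recordRadius_eventually (L := L)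
  obtain ⟨M₀, hM₀, hpk⟩ := profileDressing_package_Rpos hL2 hL hD0
  obtain ⟨M₁, -, hrec⟩ := fibreMass_pointwise_record_R hL hD0 hΩm hCΩ (fun β x hx => norm_le_of_recordProfile_ne_zero L hx) hR0 hRsmall hR1
  refine ⟨max M₀ M₁, hM₀.trans (le_max_left _ _), fun M hM θA hθA0 hθA1 hSTA => ?_⟩
  obtain ⟨n, m, W, γ, ε, κ, hκ, hP1, hP2, hP3, hP4, hγpos, hN, hWphys, hW0, hWb, hWsq, hεa, hwin, hn_m, hn01, hn_g, hnpos⟩ := hpk M ((le_max_left _ _).trans hM)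
  obtain ⟨κN', a, β₀, -, ha, hrecβ⟩ := hrec M ((le_max_right _ _).trans hM)
  -- the dressed (B-T) brick with explicit constant
  have hΩs : ∀ β (v : Edge 3 L → Fin 3 → ℝ), recordProfile L β (linkEmbed L v) ≠ 0 →
      v ∈ capBalancedSet L ∧ ‖linkEmbed L v‖ ≤ btLog β * powScale (1 / 2) β ∧ ∀ (e : Edge 3 L) (c : Fin 3), |v e c| ≤ btLog β * powScale (1 / 2) β := fun β v hv => by
    obtain ⟨h1, h2, h3⟩ := recordProfile_support L hv
    refine ⟨h1, h3.trans ((min_le_right _ _).trans (le_of_eq (mul_comm _ _))), fun e c => (h2 e c).trans ((min_le_right _ _).trans (le_of_eq (mul_comm _ _)))⟩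
  obtain ⟨κT, hκT0, hκTa, hT⟩ := dressed_hT_eventually_R_explicit (L := L) hD (Ω₀ := recordProfile L) hΩm hΩ0 (fun β x => (hΩ01 β x).2) hΩinv hΩs
    eventually_recordProfile_mass_pos (n := n) (m := m) (W := W) (εW := ε) (κN := κ) (CW := Real.sqrt (1 + κ / 4)) (κW := κ)
    hn_m hn01 hn_g hWphys hW0 hWb hκ hκ hWsq hεa hwin
  -- the objects
  obtain ⟨cR, hcRdef⟩ : ∃ cR : ℝ → ℝ, cR = fun β =>
      fpBOKernel L β (recordProfile L β) (fpWeight L (btEps β)) 1 1 / transferKernel su2Rep ((L : ℝ) ^ 3 * β) (1 : GaugeConfig 3 1 SU2) 1 / 2 / fpZ (btEps β) := ⟨_, rfl⟩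
  obtain ⟨Ω, hΩdef⟩ : ∃ Ω : ℝ → GaugeConfig 3 1 SU2 → LinkSpace L → ℝ, Ω = fun β u x => n β u * recordProfile L β x := ⟨_, rfl⟩
  obtain ⟨σ, hσdef⟩ : ∃ σ : ℝ → ℝ, σ = fun β => (if 0 < cR β then cR β else 1) / γ β := ⟨_, rfl⟩
  have hσγ : ∀ β, 0 < cR β → σ β * γ β = cR β := fun β h => by rw [hσdef]; dsimp only; rw [if_pos h]; exact div_mul_cancel₀ _ (hγpos β).ne'
  have hσpos : ∀ β, 0 < σ β := fun β => by
    rw [hσdef]; dsimp only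
    refine div_pos ?_ (hγpos β)
    by_cases h : 0 < cR β
    · rw [if_pos h]; exact h
    · rw [if_neg h]; exact one_pos
  have hr : ∀ β : ℝ, 0 ≤ min (1 / 40) (powScale (1 / 2) β * btLog β) ∧ min (1 / 40) (powScale (1 / 2) β * btLog β) ≤ 1 / 2 := fun β =>
    ⟨le_min (by norm_num) (mul_nonneg (powScale_pos _ _).le (zero_le_one.trans (one_le_btLog β))), (min_le_left _ _).trans (by norm_num)⟩
  -- ★ the normalisation comparison, eventually
  obtain ⟨a', hεa'⟩ := hεa
  have hδpos : ∀ β, 0 < D * recordDelta1 L (1 / 6) β := fun β => by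
    unfold recordDelta1; exact mul_pos (by linarith) (div_pos (mul_pos (by norm_num) (powScale_pos _ _)) (card_site_pos (L := L)))
  have hcmp : ∀ᶠ β : ℝ in atTop, (1 - θA) * (btC L β (recordProfile L β) (btEps β) (R₁ β) / fpZ (btEps β) / recordGamma L (recordProfile L) β * levelValue su2Rep 1 ((L : ℝ) ^ 3 * β) 0) ≤
      (1 - θA / 2) * (σ β * levelValue su2Rep 1 ((L : ℝ) ^ 3 * β) 0) := by
    filter_upwards [hT, hwin, hN, Filter.eventually_ge_atTop β₀, Filter.eventually_ge_atTop (0 : ℝ),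
      eventually_mul_bareLambda_sq_le (L := L) ha (show 0 < θA / 8 by positivity),
      (eventually_mul_bareLambda_sq_le (L := L) (le_max_right a' 0) (show 0 < θA / 8 by positivity)), hεa'] with β hTβ hwinβ hNβ hβ₀ hβ0 hal hal' hεβ
    have hc : 0 < cR β := by rw [hcRdef]; exact hTβ.1
    have h1' : orbitDist (1 : GaugeConfig 3 1 SU2) = 0 := orbitDist_one (L := 1)
    have h1 : orbitDist (1 : GaugeConfig 3 1 SU2) < D * recordDelta1 L (1 / 6) β := by rw [h1']; exact hδpos β
    obtain ⟨-, hm1, hm0, hnm⟩ := hwinβ 1 h1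
    rw [h1'] at hm1
    simp only [ne_eq, OfNat.ofNat_ne_zero, not_false_eq_true, zero_pow, mul_zero, zero_add] at hm1
    have hγe := hNβ 1 h1
    have hsc := fibreMassAd_scale (softWeight (recordChi L (1 / 6) (42 * D + 1) M β)) (n β) (fun _ x => recordProfile L β x) (1 : GaugeConfig 3 1 SU2)
    have hmassAd : fibreMassAd L (softWeight (recordChi L (1 / 6) (42 * D + 1) M β)) (fun _ x => recordProfile L β x) 1 =
        fibreMass L (softWeight (recordChi L (1 / 6) (42 * D + 1) M β)) (recordProfile L β) 1 := rfl
    rw [hmassAd] at hsc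
    have hγ' : n β 1 ^ 2 * fibreMass L (softWeight (recordChi L (1 / 6) (42 * D + 1) M β)) (recordProfile L β) 1 = γ β := by rw [← hsc]; exact hγe
    obtain ⟨hmass, -⟩ := hrecβ β hβ₀ 1 h1.le
    have hγA := recordGamma_recordProfile_pos L hβ0
    have hmass' : fibreMass L (softWeight (recordChi L (1 / 6) (42 * D + 1) M β)) (recordProfile L β) 1 ≤ (1 + a * bareLambda ((L : ℝ) ^ 3 * β) ^ 2) * recordGamma L (recordProfile L) β := by
      have h2 := (abs_le.mp hmass).2
      rw [h1'] at h2
      simp only [ne_eq, OfNat.ofNat_ne_zero, not_false_eq_true, zero_pow, mul_zero, zero_add] at h2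
      linarith
    have hεle : ε β ≤ θA / 8 := hεβ.trans ((mul_le_mul_of_nonneg_right (le_max_left a' 0) (sq_nonneg _)).trans hal')
    have hσe : σ β = cR β / γ β := by rw [hσdef]; dsimp only; rw [if_pos hc]
    rw [hσe, hcRdef]
    dsimp only
    exact port_comparison hθA0 hθA1
      (div_nonneg (fpBOKernel_nonneg β (hΩm β) (hCΩ β) (hΩ0 β) (measurable_coreWeight _ _) (abs_coreWeight_le _ _) (fun g => (coreWeight_mem_Icc _ _ g).1) 1 1) (transferKernel_pos _ _ _ _).le)
      (btC_le_diag β (hΩm β) (hCΩ β) (hΩ0 β) _ _) (fpZ_pos (btEps_pos_le β).1) hγA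
      (levelValue_su2Rep_nonneg 1 (by positivity) 0) hnm hm1 hm0 hγ' (hγpos β) hmass' (mul_nonneg ha (sq_nonneg _)) hal hεle
  -- ★ the assembly
  obtain ⟨hwm, hwb, hw0, -⟩ : (∀ β, Measurable (softWeight (recordChi L (1 / 6) (42 * D + 1) M β))) ∧
      (∀ β U, |softWeight (recordChi L (1 / 6) (42 * D + 1) M β) U| ≤ Real.exp ((Fintype.card (Edge 3 L) : ℝ) / powScale 1 β ^ 2)) ∧
      (∀ β U, 0 ≤ softWeight (recordChi L (1 / 6) (42 * D + 1) M β) U) ∧ True :=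
    ⟨fun β => (softWeight_recordChi_props (L := L) (1 / 6) (42 * D + 1) M β).1, fun β => (softWeight_recordChi_props (L := L) (1 / 6) (42 * D + 1) M β).2.1,
      fun β => (softWeight_recordChi_props (L := L) (1 / 6) (42 * D + 1) M β).2.2.1, trivial⟩
  have hSTR := hST_transfer_eventually (L := L) (χ := recordChi L (1 / 6) (42 * D + 1) M) hwm hwb hw0 hΩm hCΩ (n := n) hnpos hcmp hSTA
  refine ⟨Ω, W, γ, σ, κT, κ, Real.sqrt (1 + κ / 4), ⟨n, hn_m, hn01, hn_g, hnpos, hΩdef⟩, fun β => by rw [hΩdef]; exact hP1 β, fun β u x => by rw [hΩdef]; exact hP2 β u x,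
    fun β g u v => by rw [hΩdef]; exact hP3 β g u v, fun β u x h => hP4 β u x (by rw [hΩdef] at h; exact h), hWphys, hW0, hWb, hκ, hWsq, hr, hRsmall, hγpos,
    hσpos, hκT0, hκTa, ?_, ?_, ?_⟩
  · filter_upwards [hN] with β h u hu
    rw [hΩdef, h u hu, sub_self, abs_zero]
    exact mul_nonneg (hκT0 β) (hγpos β).le
  · filter_upwards [hT] with β h φ hφm hφb hφg hφs
    have hc : 0 < cR β := by rw [hcRdef]; exact h.1
    rw [hσγ β hc, hΩdef, hcRdef]
    exact h.2 φ hφm hφb hφg hφs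
  · filter_upwards [hSTR] with β h v hvm hvb hvs horth
    exact h v hvm hvb hvs (fun u => by rw [hΩdef] at horth; exact horth u)

end Summit.QuantumFields.YangMills.Theorems.FemtoTransferGap.RateTube

end
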